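import Summits.PneNP.PneNP.Theorems.ChebyshevTracialDesignBlockMaskExp
import Summits.PneNP.PneNP.Theorems.ChebyshevTracialDesignCrossingPlaneAverage
import HarnessLib

/-!
# Cell pnp-psdrank, route `ChebyshevTracialDesign`: THE UNTILTED H-SYMMETRIC MASK, AVERAGED OVER ALL MATCHINGS — brick 128c
# (crux `TracialDecayExp20`, stmt-PneNP-19878)

Brick 128c (prover g25; MEMO-28 §4 (a)). Brick 128b (`blockMask_value_le_exp`) gives `|PM|·Σ_U W(U,M)ψ(|U∩H|) ≤ 4(1+B_v)G n⁴ e^{−a′D}`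
for every NON-ALIGNED matching; here (exactly as brick 127 did for the tilted class) the ALIGNED matchings are charged to the average by the
engine's crossing-count tails (`card_pmatch_crosses_le_le` / `card_pmatch_le_crosses_le`, mass `≤ 2·2^{−⌊n/40⌋}`) and the trivial bound:

* §2 `blockMask_value_le_trivial` (`|PM|·Σ_U W(U,M)ψ ≤ G·B_v` for EVERY matching), **`blockMask_designValue_le`**: ∀ `a′ > 0` ∃ `n₀`
  ∀ `n ≥ n₀`, every balanced exact design (`1 ≤ D`, `D⁴ ≤ n`, `2D+1 ≤ T ≤ 7⌊√n⌋`), every balanced block `|H| = n/2`, every `0 ≤ ψ ≤ G`: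
  `Σ_M Σ_U W(U,M)·ψ(|U∩H|) ≤ 4·(1+B_v)·G·n⁴·(e^{−a′D} + 2^{−⌊n/40⌋})`.
* §3 **`blockMask_designValue_le_chebyshev`**: for `IsBalancedDesign n t (Tq n) (dq n) 20 C w`: `≤ 84·G·n⁴·(e^{−a′·dq n} + 2^{−⌊n/40⌋})`.
READING: the design value of EVERY nonnegative bounded `H`-symmetric mask against the crux's own weight is super-polynomially small —
virtual positivity for the untilted H-symmetric class, unconditional, ASYMPTOTIC ONLY. WHAT THIS FILE DOES NOT DO: unbalanced or several
blocks, spread strategies; anything on `TracialDecayExp20` itself, psd rank of P_PM(K_n), or P vs NP.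
[cite: Rothvoss2017, §2 (PDF pp. 5–6)] [cite: RollinRoss2010, §4.1 Thm 4.2]
Stature: support/instrument (kernel lane, no defs, axioms standard). Supports stmt-PneNP-19878.
-/

set_option linter.dupNamespace false -- `Summit.PneNP.PneNP.…`: summit = sub-problem (D-0017)

noncomputable section

namespace Summit.PneNP.PneNP.Theorems.ChebyshevTracialDesignBlockMaskAverage

open Finset Literature.Barriers.PneNP Literature.Combinatorics.Optimization
open Literature.Combinatorics.Optimization.ShellStep
open Literature.Combinatorics.SimpleGraph.CycleSpace
open Summit.PneNP.PneNP.Theorems.ChebyshevTracialDesignShellOperatorForm (designValue_eq_shellAvg)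
open Summit.PneNP.PneNP.Theorems.ChebyshevTracialDesignBlockMaskExp (blockMask_value_le_exp)
open Summit.PneNP.PneNP.Theorems.ChebyshevTracialDesignCrossingPlaneAverage (card_reps_vB_eq_card_crosses dq_Tq_facts)
open Summit.PneNP.PneNP.Theorems.ChebyshevTracialDesignCrossingCountTailsExplicit
  (card_pmatch_crosses_le_le card_pmatch_le_crosses_le)

variable {n : ℕ}

/-! ### §2 The average over all matchings -/

/-- **Trivial bound for the plain mask**: `|PM|·Σ_U W(U,M)·ψ(|U∩H|) ≤ G·B_v` for every matching (`|ψ| ≤ G` on `[0,t]`, total variation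
`≤ B_v`). [cite: Rothvoss2017, §2 (PDF p. 6)] -/
theorem blockMask_value_le_trivial {t T D : ℕ} {Bv : ℝ} {C : Finset ℕ} {w : ℕ → ℝ} (hdes : IsExactDesign n t T D Bv C w)
    (M : PMatch n) (H : Finset (Fin n)) (ψ : ℤ → ℝ) {G : ℝ} (hG0 : 0 ≤ G)
    (hG : ∀ x ∈ Icc (0 : ℤ) ((t : ℕ) : ℤ), |ψ x| ≤ G) :
    (Fintype.card (PMatch n) : ℝ) * ∑ U : OddSet n, levelWeight n t C w U M * ψ ((U.1 ∩ H).card : ℤ) ≤ G * Bv := by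
  have hPM : (Fintype.card (PMatch n) : ℝ) ≠ 0 := by
    have : 0 < Fintype.card (PMatch n) := Fintype.card_pos_iff.2 ⟨M⟩
    positivity
  rw [designValue_eq_shellAvg t hdes.1 C w M (fun U' => ψ ((U' ∩ H).card : ℤ)), ← mul_assoc, mul_inv_cancel₀ hPM, one_mul]
  have havg : ∀ c ∈ C, |(∑ U' ∈ shell M.2.partner t c, ψ ((U' ∩ H).card : ℤ)) / ((shell M.2.partner t c).card : ℝ)| ≤ G := by
    intro c _
    have hb : ∀ U' ∈ shell M.2.partner t c, |ψ ((U' ∩ H).card : ℤ)| ≤ G := by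
      intro U' hU'
      have hUt : U'.card = t := ((mem_shell).1 hU').1
      refine hG _ (mem_Icc.2 ⟨by positivity, ?_⟩)
      have := card_le_card (inter_subset_left (s₁ := U') (s₂ := H))
      rw [hUt] at this; exact_mod_cast this
    by_cases h0 : (shell M.2.partner t c).card = 0
    · rw [h0, Nat.cast_zero, div_zero, abs_zero]; exact hG0
    have hpos : (0 : ℝ) < (shell M.2.partner t c).card := by positivity
    rw [abs_div, abs_of_pos hpos, div_le_iff₀ hpos]
    refine (abs_sum_le_sum_abs _ _).trans ?_
    calc _ ≤ ∑ _U' ∈ shell M.2.partner t c, G := sum_le_sum hb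
      _ = G * (shell M.2.partner t c).card := by rw [sum_const, nsmul_eq_mul]; ring
  have hvar : ∑ c ∈ C, |w c| ≤ Bv := hdes.2.2.2.2.2.2
  refine (le_abs_self _).trans ((abs_sum_le_sum_abs _ _).trans ?_)
  calc _ ≤ ∑ c ∈ C, |w c| * G := by
        refine sum_le_sum fun c hc => ?_
        rw [abs_mul]
        exact mul_le_mul_of_nonneg_left (havg c hc) (abs_nonneg _)
    _ = (∑ c ∈ C, |w c|) * G := by rw [sum_mul]
    _ ≤ Bv * G := mul_le_mul_of_nonneg_right hvar hG0
    _ = G * Bv := by ring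

/-- **THE UNTILTED H-SYMMETRIC MASK, AVERAGED OVER ALL MATCHINGS (brick 128b §2).** For every `a′ > 0` there is `n₀` such that for all
`n ≥ n₀`: for every balanced exact design (`1 ≤ D`, `D⁴ ≤ n`, `2D+1 ≤ T ≤ 7⌊√n⌋`), every balanced block `|H| = n/2` and every `0 ≤ ψ ≤ G`
on `[0,t]`: `Σ_M Σ_U W(U,M)·ψ(|U∩H|) ≤ 4·(1+B_v)·G·n⁴·(e^{−a′D} + 2^{−⌊n/40⌋})`. [cite: Rothvoss2017, §2 (PDF pp. 5–6)] -/
theorem blockMask_designValue_le {a' : ℝ} (ha' : 0 < a') :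
    ∃ n₀ : ℕ, ∀ n : ℕ, n₀ ≤ n → ∀ {t T D : ℕ} {Bv : ℝ} {C : Finset ℕ} {w : ℕ → ℝ},
    IsExactDesign n t T D Bv C w → 2 * D + 1 ≤ T → n ≤ 4 * t → 1 ≤ D → D ^ 4 ≤ n → T ≤ 7 * Nat.sqrt n →
    ∀ (H : Finset (Fin n)), 2 * H.card = n →
    ∀ (ψ : ℤ → ℝ) {G : ℝ}, 0 ≤ G → (∀ x ∈ Icc (0 : ℤ) ((t : ℕ) : ℤ), |ψ x| ≤ G) →
    (∀ x ∈ Icc (0 : ℤ) ((t : ℕ) : ℤ), 0 ≤ ψ x) →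
    ∑ M : PMatch n, ∑ U : OddSet n, levelWeight n t C w U M * ψ ((U.1 ∩ H).card : ℤ) ≤
      4 * (1 + Bv) * G * (n : ℝ) ^ 4 * (Real.exp (-(a' * D)) + (1 / 2 : ℝ) ^ (n / 40)) := by
  obtain ⟨n₁, h1⟩ := blockMask_value_le_exp (β := 1 / 40) (a' := a') (by norm_num) ha'
  refine ⟨max n₁ 80, ?_⟩
  intro n hn t T D Bv C w hdes hDT hbal hD1 hD4 hT7 H hH ψ G hG0 hG hψ0
  have hn₁ : n₁ ≤ n := le_trans (le_max_left _ _) hn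
  have hn80 : 80 ≤ n := le_trans (le_max_right _ _) hn
  have hBv : 0 ≤ Bv := le_trans (sum_nonneg fun c _ => abs_nonneg _) hdes.2.2.2.2.2.2
  set V : PMatch n → ℝ := fun M => (Fintype.card (PMatch n) : ℝ) * ∑ U : OddSet n,
    levelWeight n t C w U M * ψ ((U.1 ∩ H).card : ℤ) with hVdef
  obtain ⟨B₁, hB₁⟩ : ∃ e : ℝ, e = 4 * (1 + Bv) * G * (n : ℝ) ^ 4 * Real.exp (-(a' * D)) := ⟨_, rfl⟩
  obtain ⟨B₂, hB₂⟩ : ∃ e : ℝ, e = G * Bv := ⟨_, rfl⟩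
  have hB₁0 : 0 ≤ B₁ := by rw [hB₁]; positivity
  have hB₂0 : 0 ≤ B₂ := by rw [hB₂]; positivity
  obtain ⟨a₀, ha₀⟩ : ∃ a : ℕ, a = n / 40 := ⟨_, rfl⟩
  set good : Finset (PMatch n) := univ.filter fun M => a₀ < (M.1.filter (Crosses H)).card ∧
    (M.1.filter (Crosses H)).card + a₀ < H.card with hgood
  have hgoodV : ∀ M ∈ good, V M ≤ B₁ := by
    intro M hM
    obtain ⟨h1', h2⟩ := (mem_filter.1 hM).2
    rw [← card_reps_vB_eq_card_crosses M H] at h1' h2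
    have ha : (n : ℝ) ≤ 40 * ((a₀ : ℝ) + 1) := by
      have : n < 40 * (a₀ + 1) := by omega
      exact_mod_cast this.le
    have hlo : (1 / 40 : ℝ) * n ≤ (reps M.2.partner (vBH M.2.partner univ H ∪ vBN M.2.partner univ H)).card := by
      have : ((a₀ + 1 : ℕ) : ℝ) ≤ (reps M.2.partner (vBH M.2.partner univ H ∪ vBN M.2.partner univ H)).card := by
        exact_mod_cast h1'
      push_cast at this; linarith
    have hhi : ((reps M.2.partner (vBH M.2.partner univ H ∪ vBN M.2.partner univ H)).card : ℝ) ≤ (1 / 2 - 1 / 40) * n := by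
      have : (((reps M.2.partner (vBH M.2.partner univ H ∪ vBN M.2.partner univ H)).card + a₀ + 1 : ℕ) : ℝ) ≤
          H.card := by exact_mod_cast h2
      have hHr : (H.card : ℝ) = (n : ℝ) / 2 := by
        have : ((2 * H.card : ℕ) : ℝ) = n := by exact_mod_cast hH
        push_cast at this; linarith
      push_cast at this; linarith
    rw [hB₁]
    exact h1 n hn₁ hdes hDT hbal hD1 hD4 hT7 M H hH hlo hhi ψ hG0 hG hψ0
  have hallV : ∀ M, V M ≤ B₂ := fun M => by rw [hB₂]; exact blockMask_value_le_trivial hdes M H ψ hG0 hG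
  have hHc : 9 * a₀ + 1 ≤ H.card ∧ 9 * a₀ + 1 ≤ n - H.card ∧ n - H.card = H.card ∧ 9 * (a₀ + 1) ≤ H.card := by omega
  have hbad : (((univ.filter fun M : PMatch n => ¬ (a₀ < (M.1.filter (Crosses H)).card ∧
      (M.1.filter (Crosses H)).card + a₀ < H.card)).card : ℕ) : ℝ) ≤
      2 * (1 / 2 : ℝ) ^ a₀ * (Fintype.card (PMatch n) : ℝ) := by
    have hsub : (univ.filter fun M : PMatch n => ¬ (a₀ < (M.1.filter (Crosses H)).card ∧
        (M.1.filter (Crosses H)).card + a₀ < H.card)) ⊆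
        (univ.filter fun M : PMatch n => (M.1.filter (Crosses H)).card ≤ a₀) ∪
        (univ.filter fun M : PMatch n => H.card ≤ (M.1.filter (Crosses H)).card + a₀) := by
      intro M hM
      rw [mem_filter] at hM
      rw [mem_union, mem_filter, mem_filter]
      by_cases h : (M.1.filter (Crosses H)).card ≤ a₀
      · exact Or.inl ⟨mem_univ _, h⟩
      · right; refine ⟨mem_univ _, ?_⟩
        by_contra h'
        exact hM.2 ⟨by omega, by omega⟩
    have h1' := card_pmatch_crosses_le_le H hHc.1 hHc.2.1
    have h2 := card_pmatch_le_crosses_le H hHc.2.2.1 hHc.2.2.2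
    have h3 : (((univ.filter fun M : PMatch n => ¬ (a₀ < (M.1.filter (Crosses H)).card ∧
        (M.1.filter (Crosses H)).card + a₀ < H.card)).card : ℕ) : ℝ) ≤
        (((univ.filter fun M : PMatch n => (M.1.filter (Crosses H)).card ≤ a₀).card : ℕ) : ℝ) +
        (((univ.filter fun M : PMatch n => H.card ≤ (M.1.filter (Crosses H)).card + a₀).card : ℕ) : ℝ) := by
      exact_mod_cast (card_le_card hsub).trans (card_union_le _ _)
    linarith
  have hPMpos : ∀ M : PMatch n, (0 : ℝ) < Fintype.card (PMatch n) := fun M => by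
    have : 0 < Fintype.card (PMatch n) := Fintype.card_pos_iff.2 ⟨M⟩
    exact_mod_cast this
  have hsumV : ∑ M : PMatch n, ∑ U : OddSet n, levelWeight n t C w U M * ψ ((U.1 ∩ H).card : ℤ) =
      ∑ M : PMatch n, (Fintype.card (PMatch n) : ℝ)⁻¹ * V M := by
    refine sum_congr rfl fun M _ => ?_
    rw [hVdef]
    simp only []
    rw [← mul_assoc, inv_mul_cancel₀ (hPMpos M).ne', one_mul]
  rw [hsumV, ← mul_sum, ← sum_filter_add_sum_filter_not univ (fun M : PMatch n =>
    a₀ < (M.1.filter (Crosses H)).card ∧ (M.1.filter (Crosses H)).card + a₀ < H.card)]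
  have hgood_sum : ∑ M ∈ good, V M ≤ (good.card : ℝ) * B₁ := by
    rw [← nsmul_eq_mul, ← sum_const]; exact sum_le_sum hgoodV
  have hbad_sum : ∑ M ∈ univ.filter (fun M : PMatch n => ¬ (a₀ < (M.1.filter (Crosses H)).card ∧
      (M.1.filter (Crosses H)).card + a₀ < H.card)), V M ≤
      ((univ.filter fun M : PMatch n => ¬ (a₀ < (M.1.filter (Crosses H)).card ∧
        (M.1.filter (Crosses H)).card + a₀ < H.card)).card : ℝ) * B₂ := by
    rw [← nsmul_eq_mul, ← sum_const]; exact sum_le_sum fun M _ => hallV M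
  have hgood_card : (good.card : ℝ) ≤ Fintype.card (PMatch n) := by exact_mod_cast card_le_univ good
  by_cases hPM : Fintype.card (PMatch n) = 0
  · have : IsEmpty (PMatch n) := Fintype.card_eq_zero_iff.1 hPM
    simp only [univ_eq_empty, filter_empty, sum_empty, add_zero, mul_zero]
    positivity
  have hPMr : (0 : ℝ) < Fintype.card (PMatch n) := by
    have : 0 < Fintype.card (PMatch n) := Nat.pos_of_ne_zero hPM
    exact_mod_cast this
  rw [← hgood]
  calc (Fintype.card (PMatch n) : ℝ)⁻¹ * (∑ M ∈ good, V M +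
        ∑ M ∈ univ.filter (fun M : PMatch n => ¬ (a₀ < (M.1.filter (Crosses H)).card ∧
          (M.1.filter (Crosses H)).card + a₀ < H.card)), V M)
      ≤ (Fintype.card (PMatch n) : ℝ)⁻¹ * ((Fintype.card (PMatch n) : ℝ) * B₁ +
          (2 * (1 / 2 : ℝ) ^ a₀ * (Fintype.card (PMatch n) : ℝ)) * B₂) := by
        refine mul_le_mul_of_nonneg_left ?_ (by positivity)
        nlinarith [hgood_sum, hbad_sum, hgood_card, hbad, hB₁0, hB₂0]
    _ = B₁ + 2 * (1 / 2 : ℝ) ^ a₀ * B₂ := by field_simp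
    _ ≤ 4 * (1 + Bv) * G * (n : ℝ) ^ 4 * (Real.exp (-(a' * D)) + (1 / 2 : ℝ) ^ (n / 40)) := by
        rw [hB₁, hB₂, ha₀, mul_add]
        have hn1 : (1 : ℝ) ≤ n := by exact_mod_cast (show 1 ≤ n by omega)
        have hn14 : (1 : ℝ) ≤ (n : ℝ) ^ 4 := one_le_pow₀ hn1
        have hp : (0 : ℝ) ≤ (1 / 2 : ℝ) ^ (n / 40) := by positivity
        have : 2 * (1 / 2 : ℝ) ^ (n / 40) * (G * Bv) ≤ 4 * (1 + Bv) * G * (n : ℝ) ^ 4 * (1 / 2 : ℝ) ^ (n / 40) := by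
          have h18 : 2 * (G * Bv) ≤ 4 * ((1 + Bv) * G * (n : ℝ) ^ 4) := by
            nlinarith [mul_nonneg hG0 hBv, mul_le_mul_of_nonneg_left hn14 (mul_nonneg hG0 hBv),
              mul_nonneg hG0 (pow_nonneg (by linarith : (0:ℝ) ≤ n) 4)]
          nlinarith [mul_le_mul_of_nonneg_left h18 hp]
        linarith

/-! ### §3 In the crux's own parameters -/

/-- **Brick 128b in the crux's vocabulary.** For every `a′ > 0` there is `n₀` such that for all `n ≥ n₀`, every
`IsBalancedDesign n t (Tq n) (dq n) 20 C w`, every balanced block `|H| = n/2` and every `0 ≤ ψ ≤ G` on `[0,t]`: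
`Σ_M Σ_U W(U,M)·ψ(|U∩H|) ≤ 84·G·n⁴·(e^{−a′·dq n} + 2^{−⌊n/40⌋})`. [cite: Rothvoss2017, §2 (PDF p. 6)] -/
theorem blockMask_designValue_le_chebyshev {a' : ℝ} (ha' : 0 < a') :
    ∃ n₀ : ℕ, ∀ n : ℕ, n₀ ≤ n → ∀ {t : ℕ} {C : Finset ℕ} {w : ℕ → ℝ},
    IsBalancedDesign n t (Tq n) (dq n) 20 C w →
    ∀ (H : Finset (Fin n)), 2 * H.card = n →
    ∀ (ψ : ℤ → ℝ) {G : ℝ}, 0 ≤ G → (∀ x ∈ Icc (0 : ℤ) ((t : ℕ) : ℤ), |ψ x| ≤ G) →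
    (∀ x ∈ Icc (0 : ℤ) ((t : ℕ) : ℤ), 0 ≤ ψ x) →
    ∑ M : PMatch n, ∑ U : OddSet n, levelWeight n t C w U M * ψ ((U.1 ∩ H).card : ℤ) ≤
      84 * G * (n : ℝ) ^ 4 * (Real.exp (-(a' * dq n)) + (1 / 2 : ℝ) ^ (n / 40)) := by
  obtain ⟨n₁, h⟩ := blockMask_designValue_le ha'
  refine ⟨max n₁ 16, ?_⟩
  intro n hn t C w hdes H hH ψ G hG0 hG hψ0
  obtain ⟨h1, h2, h3, h4⟩ := dq_Tq_facts (le_trans (le_max_right _ _) hn)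
  have h' := h n (le_trans (le_max_left _ _) hn) hdes.1 h3 hdes.2 (by omega) h1 h4 H hH ψ hG0 hG hψ0
  refine h'.trans (le_of_eq ?_)
  ring

end Summit.PneNP.PneNP.Theorems.ChebyshevTracialDesignBlockMaskAverage

end
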